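import Mathlib
import Literature.Analysis.FluidPDE.VectorCalculus
import Literature.Analysis.FluidPDE.SteadyNSClassicalRegularity
import Literature.Analysis.FluidPDE.NSBoundedMildSmoothing
import Summits.NavierStokesRegularity.NavierStokesRegularity.Theses.UnthreadedRigidityDoor
import Summits.NavierStokesRegularity.NavierStokesRegularity.Theorems.UnthreadedRigidityDoorWindowAnalytic
import Summits.NavierStokesRegularity.NavierStokesRegularity.Theorems.ThreadingFluxCentreJetDefs
import Summits.NavierStokesRegularity.NavierStokesRegularity.Theorems.ThreadingFluxCentreJetSteadyFacts
import Summits.NavierStokesRegularity.NavierStokesRegularity.Theorems.ThreadingFluxSilentShellsTwoAxesTools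
import Summits.NavierStokesRegularity.NavierStokesRegularity.Theorems.ThreadingFluxPlatonicDefs
import Summits.NavierStokesRegularity.NavierStokesRegularity.Theorems.ThreadingFluxPlatonicSteadyStratum
import Summits.NavierStokesRegularity.NavierStokesRegularity.Theorems.ThreadingFluxPlatonicSymmetryAlgebra
import HarnessLib

/-!
# Crux `UnthreadedRigidity` (stmt-NavierStokesRegularity-27585, wall W2) / `PoloidalLiouville` (stmt-…-1222, W1), crux idea
# «platonic-germ-sieve» (ns-idea-15 g11, V27): the W2 WIRING — `UnthreadedRigidity → SymmetricWindowRigidity octahedral`, kernel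

Support file (Theorems-side; seat ns-wall-eng-8 g6, cell `ns-wall-extremal`; `--supports stmt-NavierStokesRegularity-1222 --as helper`;
0 kit), over the Defs twin `ThreadingFluxPlatonicDefs.lean`.  The sketch `Cruxes/PoloidalLiouville/PlatonicSketch.lean` types
`SymmetricWindowRigidity G` (W2 restricted to a symmetry class, conclusion «the window solution VANISHES») and says (docstring, l.262):
«Glue from `UnthreadedRigidity` is NOT kernel-proved here: it needs "the symmetry algebra of a `G`-equivariant field is `G`-conjugation
invariant" and "rotations about two non-parallel axes generate SO(3)", then "a continuous SO(3)-equivariant divergence-free field on `ℝ³`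
is `0`".  OPEN.»  This file proves that glue for the octahedral class:

* ★★ `Platonic.symmetricWindowRigidity_of_unthreadedRigidity : UnthreadedRigidityDoor.UnthreadedRigidity → SymmetricWindowRigidity octahedral`;
* `Platonic.not_unthreadedRigidity_of_octahedralWindowSolution` — the negation home it opens on W2: ONE non-zero O-equivariant unthreaded
  bounded Oseen-mild window solution refutes ⟨27585⟩ (explicit binders, no new Prop);
* ★ `Platonic.symmetricSteadyLiouville_octahedral_of_unthreadedRigidity : UnthreadedRigidity → SymmetricSteadyLiouville octahedral` — the
  STEADY octahedral stratum of W1 follows from ⟨27585⟩ ALONE (a bounded classical steady flow is an Oseen-mild window solution on `S = ℝ`: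
  tree `CentreJet.steady_oseen_identity` through the `C² → C³` bridge); so that stratum is now reached from EITHER the sieve's conjecture
  (`…SteadyStratum.symmetricSteadyLiouville_octahedral_of_centreRigidity`) OR W2's crux;
* `Platonic.octahedral_preservesNoAxis : PreservesNoAxis octahedral` — the sketch's kernel instance, over the twin names.

PROOF (no Lie-group generation, no integration of rotation flows).  The window hypotheses are EXACTLY those of the tree theorem
`UnthreadedRigidity.windowAnalytic` (`Theorems/UnthreadedRigidityDoorWindowAnalytic.lean`), so every slice `W = u(t)`, `t ∈ S`, is
real-analytic on `ℝ³` and all `fderiv`s below are honest derivatives.  ⟨27585⟩ at `x₀ = 0` gives a skew `A ≠ 0` with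
`DW(x)[A x] = A W(x)`; skew maps of `ℝ³` are cross products (`SilentShells.TwoAxes.exists_cross_of_skew`), `A = w × ·`, `w ≠ 0`.
O-equivariance transports this identity along the rotations of the cube and the good axial vectors form a subspace, which is all of
`ℝ³` (`Platonic.fderiv_cross_all_of_octahedral`: half-turns isolate `wᵢeᵢ`, the 3-cycle moves a non-zero one around).  A `C¹`
divergence-free field infinitesimally equivariant under every rotation vanishes (`Platonic.eq_zero_of_fderiv_cross_all`: `‖x‖²W = m x`,
`Dm(x)[x] = −m`, `s ↦ s·m(sx)` constant).

HONEST LABEL: a reduction between typed statements of one idea card (glue); the load-bearing statement `UnthreadedRigidity` (27585) is the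
OPEN crux of W2 and is NOT touched; `SymmetricWindowRigidity octahedral`, `PoloidalLiouville` (1222) and NS regularity remain OPEN;
information-grade (movement 0).  [folklore]
-/

-- the summit and its single sub-problem share the name (CONVENTIONS §1)
set_option linter.dupNamespace false

noncomputable section

open Set Function Filter Metric
open scoped RealInnerProductSpace Topology
open Literature.Analysis.FluidPDE
open Summit.NavierStokesRegularity.NavierStokesRegularity.Theses
open Summit.NavierStokesRegularity.NavierStokesRegularity.Theorems.PoloidalLiouville.CentreJet (E3)
open Summit.NavierStokesRegularity.NavierStokesRegularity.Theorems.PoloidalLiouville.SilentShells (TwoAxes.exists_cross_of_skew)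

namespace Summit.NavierStokesRegularity.NavierStokesRegularity.Theorems.PoloidalLiouville.Platonic

/-! ### The octahedral group preserves no axis (sketch's kernel glue, over the twin names) -/

/-- O preserves no axis (the quarter-turns about `e₀` and `e₂` already do it).  The hypothesis under which every axis-based W1/W2
mechanism is void in the class. -/
theorem octahedral_preservesNoAxis : PreservesNoAxis octahedral := by
  intro a ha
  by_contra hcon
  push Not at hcon
  -- quarter-turn about e₀ : x ↦ (x₀, -x₂, x₁)
  have d1 : IsCubeRotationData (Equiv.swap 1 2) ![1, -1, 1] :=
    ⟨by intro i; fin_cases i <;> simp, by simp [Fin.prod_univ_three, Equiv.Perm.sign_swap']⟩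
  -- quarter-turn about e₂ : x ↦ (-x₁, x₀, x₂)
  have d2 : IsCubeRotationData (Equiv.swap 0 1) ![-1, 1, 1] :=
    ⟨by intro i; fin_cases i <;> simp, by simp [Fin.prod_univ_three, Equiv.Perm.sign_swap']⟩
  obtain ⟨c, hc⟩ := hcon _ ⟨Equiv.swap 1 2, ![1, -1, 1], d1, rfl⟩
  obtain ⟨c', hc'⟩ := hcon _ ⟨Equiv.swap 0 1, ![-1, 1, 1], d2, rfl⟩
  have e1 := congrArg (fun v : E3 => v 1) hc
  have e2 := congrArg (fun v : E3 => v 2) hc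
  have f0 := congrArg (fun v : E3 => v 0) hc'
  have f1 := congrArg (fun v : E3 => v 1) hc'
  simp [cubeRot, Equiv.swap_apply_def] at e1 e2 f0 f1
  -- e1 : -a 2 = c * a 1, e2 : a 1 = c * a 2, f0 : -a 1 = c' * a 0, f1 : a 0 = c' * a 1
  have s12 : a 1 ^ 2 + a 2 ^ 2 = 0 := by linear_combination a 1 * e2 - a 2 * e1
  have s01 : a 0 ^ 2 + a 1 ^ 2 = 0 := by linear_combination a 0 * f1 - a 1 * f0
  have h1 : a 1 = 0 := (pow_eq_zero_iff two_ne_zero).mp (by nlinarith [sq_nonneg (a 1), sq_nonneg (a 2)])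
  have h2 : a 2 = 0 := (pow_eq_zero_iff two_ne_zero).mp (by nlinarith [sq_nonneg (a 1), sq_nonneg (a 2)])
  have h0 : a 0 = 0 := (pow_eq_zero_iff two_ne_zero).mp (by nlinarith [sq_nonneg (a 0), sq_nonneg (a 1)])
  apply ha
  ext i
  fin_cases i <;> simp [h0, h1, h2]

/-! ### Slices of a window solution are smooth -/

/-- Every slice `u(t)`, `t ∈ S`, of a bounded divergence-free Oseen-mild window solution is real-analytic on `ℝ³`
(`UnthreadedRigidity.windowAnalytic`, joint analyticity, restricted to the slice). -/
theorem analyticOnNhd_slice {S : Set ℝ} (hS : IsOpen S) (hpre : IsPreconnected S) {u : ℝ → E3 → E3}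
    (hcont : ContinuousOn (Function.uncurry u) (S ×ˢ univ))
    (hdiv : ∀ t ∈ S, VectorCalculus.IsDivFree (u t))
    (hmild : ∀ s ∈ S, ∀ t ∈ S, s < t → ∀ x, u t x =
        Literature.Analysis.UnboundedOperators.heatExtension (u s) (t - s) x - oseenDuhamel 1 s u u t x)
    (hbdd : ∀ τ ∈ S, ∃ B : ℝ, ∀ t ∈ S, t ≤ τ → ∀ x, ‖u t x‖ ≤ B) {t : ℝ} (ht : t ∈ S) :
    AnalyticOnNhd ℝ (u t) univ := by
  have han := (UnthreadedRigidity.windowAnalytic S u hS hpre hcont hdiv hmild hbdd).1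
  intro x _
  have hz : AnalyticAt ℝ (Function.uncurry u) (t, x) := han (t, x) ⟨ht, mem_univ x⟩
  have hι : AnalyticAt ℝ (fun y : E3 => ((t, y) : ℝ × E3)) x := analyticAt_const.prod analyticAt_id
  exact hz.comp hι

/-! ### ★★ The W2 wiring -/

/-- ★★ **W2 restricted to the octahedral class follows from ⟨27585⟩ (kernel glue, the sketch's paper-only wiring).**  If
`UnthreadedRigidity` holds, then every continuous, divergence-free, bounded, Oseen-mild window solution on an open preconnected time set,
unthreaded about `0` and O-equivariant at every time, VANISHES identically. -/
theorem symmetricWindowRigidity_of_unthreadedRigidity (h27585 : UnthreadedRigidityDoor.UnthreadedRigidity) :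
    SymmetricWindowRigidity octahedral := by
  intro S hS hpre u hcont hdiv hmild hbdd hun hequi t ht x
  -- ⟨27585⟩ at the centre `0`: one infinitesimal axis
  obtain ⟨A, hAskew, hAne, hAeq⟩ := h27585 S hS hpre u 0 hcont hdiv hmild hbdd
    (fun t ht x => by rw [sub_zero]; exact hun t ht x)
  -- the slice is analytic, hence C¹ / C² and differentiable
  have hWan : AnalyticOnNhd ℝ (u t) univ := analyticOnNhd_slice hS hpre hcont hdiv hmild hbdd ht
  have hW1 : ContDiff ℝ 1 (u t) := contDiffOn_univ.1 hWan.contDiffOn_of_completeSpace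
  have hWd : Differentiable ℝ (u t) := hW1.differentiable one_ne_zero
  -- `A = w × ·` with `w ≠ 0` (polarisation, then skew maps of `ℝ³` are cross products)
  have hskew : ∀ x y : E3, ⟪A x, y⟫ = -⟪x, A y⟫ := by
    intro x y
    have h := hAskew (x + y)
    rw [map_add, inner_add_left, inner_add_right, inner_add_right, hAskew x, hAskew y, zero_add, add_zero] at h
    have hc : ⟪x, A y⟫ = ⟪A y, x⟫ := real_inner_comm (A y) x
    linarith
  obtain ⟨w, hw⟩ := TwoAxes.exists_cross_of_skew A hskew
  have hw0 : w ≠ 0 := by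
    intro h0
    apply hAne
    ext y i
    simp [hw y, h0, cross, crossProduct]
  -- the identity about `w`, then about every axial vector, then `u t = 0`
  have hPw : ∀ y, fderiv ℝ (u t) y (cross w y) = cross w (u t y) := fun y => by
    have h := hAeq t ht y
    rw [sub_zero, hw, hw, sub_eq_zero] at h
    exact h
  have hall := fderiv_cross_all_of_octahedral hWd (hequi t ht) hw0 hPw
  have hzero : u t = 0 := eq_zero_of_fderiv_cross_all hW1 (hdiv t ht) hall
  simp [hzero]

/-- **The negation home this opens on W2**: a single non-zero O-equivariant, unthreaded, bounded, divergence-free Oseen-mild window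
solution refutes ⟨27585⟩ `UnthreadedRigidity` (explicit binders; compare the sketch's `SymmetricCounterexample` on the W1 side). -/
theorem not_unthreadedRigidity_of_octahedralWindowSolution {S : Set ℝ} (hS : IsOpen S) (hpre : IsPreconnected S)
    {u : ℝ → E3 → E3} (hcont : ContinuousOn (Function.uncurry u) (S ×ˢ univ))
    (hdiv : ∀ t ∈ S, VectorCalculus.IsDivFree (u t))
    (hmild : ∀ s ∈ S, ∀ t ∈ S, s < t → ∀ x, u t x =
        Literature.Analysis.UnboundedOperators.heatExtension (u s) (t - s) x - oseenDuhamel 1 s u u t x)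
    (hbdd : ∀ τ ∈ S, ∃ B : ℝ, ∀ t ∈ S, t ≤ τ → ∀ x, ‖u t x‖ ≤ B)
    (hun : ∀ t ∈ S, ∀ x, inner ℝ (curl (u t) x) x = 0) (hequi : ∀ t ∈ S, IsEquivariant octahedral (u t))
    {t : ℝ} (ht : t ∈ S) {x : E3} (hx : u t x ≠ 0) : ¬ UnthreadedRigidityDoor.UnthreadedRigidity := fun h =>
  hx (symmetricWindowRigidity_of_unthreadedRigidity h S hS hpre u hcont hdiv hmild hbdd hun hequi t ht x)

/-! ### ★ The steady octahedral stratum from ⟨27585⟩ alone -/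

/-- ★ **The steady octahedral stratum of W1 from ⟨27585⟩ alone.**  If `UnthreadedRigidity` holds, every bounded classical steady NS flow on
`ℝ³` that is unthreaded about `0` and O-equivariant vanishes identically (apply the W2 wiring to the constant-in-time window solution on
`S = ℝ`).  Second route to `SymmetricSteadyLiouville octahedral`, independent of the sieve's conjecture `OctahedralCentreRigidity`. -/
theorem symmetricSteadyLiouville_octahedral_of_unthreadedRigidity (h27585 : UnthreadedRigidityDoor.UnthreadedRigidity) :
    SymmetricSteadyLiouville octahedral := by
  intro V p hNS hB hun heq x
  obtain ⟨B, hBV⟩ := hB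
  have hVc : Continuous V := (contDiffOn_univ.1 hNS.1).continuous
  have hcont : ContinuousOn (Function.uncurry (fun _ : ℝ => V)) ((univ : Set ℝ) ×ˢ (univ : Set E3)) :=
    (hVc.comp continuous_snd).continuousOn
  have hdiv : ∀ t ∈ (univ : Set ℝ), VectorCalculus.IsDivFree ((fun _ : ℝ => V) t) :=
    fun _ _ y => hNS.2.2.1 y (mem_univ y)
  have hmild : ∀ s ∈ (univ : Set ℝ), ∀ t ∈ (univ : Set ℝ), s < t → ∀ y, (fun _ : ℝ => V) t y =
      Literature.Analysis.UnboundedOperators.heatExtension ((fun _ : ℝ => V) s) (t - s) y -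
        oseenDuhamel 1 s (fun _ : ℝ => V) (fun _ : ℝ => V) t y :=
    fun s _ t _ hst y => CentreJet.steady_oseen_identity (centreJet_isSteadyNSOn_of_bounded hNS ⟨B, hBV⟩) hBV hst y
  have hbdd : ∀ τ ∈ (univ : Set ℝ), ∃ B' : ℝ, ∀ t ∈ (univ : Set ℝ), t ≤ τ → ∀ y, ‖(fun _ : ℝ => V) t y‖ ≤ B' :=
    fun _ _ => ⟨B, fun _ _ _ y => hBV y⟩
  have hun' : ∀ t ∈ (univ : Set ℝ), ∀ y, inner ℝ (curl ((fun _ : ℝ => V) t) y) y = 0 :=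
    fun _ _ y => by rw [real_inner_comm]; exact hun y
  have hequi : ∀ t ∈ (univ : Set ℝ), IsEquivariant octahedral ((fun _ : ℝ => V) t) := fun _ _ => heq
  exact symmetricWindowRigidity_of_unthreadedRigidity h27585 univ isOpen_univ isPreconnected_univ (fun _ : ℝ => V)
    hcont hdiv hmild hbdd hun' hequi 0 (mem_univ _) x

end Summit.NavierStokesRegularity.NavierStokesRegularity.Theorems.PoloidalLiouville.Platonic

end
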